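import Mathlib

/-!
# Venture HSemireg — W3 SPECIAL FIBRES, Jacobian-type points inside Π: the arithmetic hearts of the
# RIES structure / strata / class census of Schoen's carrier (seat `w3-jac-1` g9, file of record
# `widen/W3/W3-JAC-1-RIES.md` v1.2, §1, §2, §4, §6.4)

HONEST FRAMING. Lean index of the computation cell `pub-hsemireg`, widening seat `w3-jac-1`.  ELEMENTARY
ALGEBRA AND ARITHMETIC ONLY: no curve, no Prym variety, no symmetric product, no cohomology ring and no
deformation is constructed here.  On paper (RIES §1) the members of the étale μ₃-Prym family with
hyperelliptic base of genus `r` carry an `S₃`-action whose reflection quotients `C'` have genus `d = r − 1`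
(Riemann–Hurwitz with `2r + 2` fixed points: `ries_genus`; the trigonal map is simply branched at
`2d + 4 = 2r + 2` points: `trigonal_branch_points`), the isotypic bookkeeping of `H¹(C̃, ℚ)` reads
`sgn^{2r} ⊕ std^{2d}` (`isotypic_bookkeeping`), and the polarisation `Tr ⊗ θ` on `J(C') ⊗ ℤ[ζ₃]` has Gram
determinant `3` on `ℤ[ζ₃]` and Pfaffian `3^d` — equal to the Pfaffian of the Prym polarisation of type
`(1^d, 3^d)`, so the comparison isogeny has degree `1` (`trace_form_det`, `pfaffian_degree_one`).  On paper
(RIES §4.5, THEOREM CENSUS∞) the class of the degenerate carrier is `Ξ^d/(3·d!) + w_t` with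
`w_t = ((−1)^d/3)(ω^t Ω + ω^{−t} Ω̄)` and `Ω·Ω̄ = (−3)^d`, whence `B(w_t, w_t) = (2/9)(−3)^d = (−1)^d·2·3^{d−2}`
(`weil_self_pairing`) and the self-intersection / degree numbers `0, 8, 54, 648` and `2, 36, 1080, 45360`
(`census_numbers_d_le_4`), the multinomial bookkeeping at `d = 4` (`type_zero_multinomials`,
`xi_shares_sum_to_one`, `intersection_matrix_total`).  On paper (RIES §6.4) the trigonal correspondence curve
has class `θ − 2x` on `C'^{(2)}` and the trigonal bisecant divisor class `2x + θ` on `C'^{(4)}`, from two linear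
conditions each (`trigonal_pair_class`, `bisecant_class`; calibration `diagonal_class`/`diagonal_self_int`),
and the degree of `T¹` on the test curve is `(2·2 + 4) − 6 = 2 ≠ 0` (`not_d_semistable_degree`); the control
count `12·1 + 4·2 = 2·2 + 16` (`bisecant_control_count`).  Nothing here says that HC, HC_CM or HC_AV holds,
that any object is semiregular, or that the geometric hypotheses of RIES §1–§6 are met; the tiers of the
paper statements are the W3 pen's.

CONTENT (all PROVED, 0 sorry), namespace `Summit.Ventures.HSemireg.SchoenCarrierRiesCensus`.
-/

namespace Summit.Ventures.HSemireg.SchoenCarrierRiesCensus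

/-- RIES §1.1: Riemann–Hurwitz for the double cover `C̃ → C' = C̃/ι̃` with `2r + 2` fixed points,
`2(3r − 2) − 2 = 2(2g' − 2) + (2r + 2)`, forces `g' = r − 1`. -/
theorem ries_genus (r g' : ℤ) (h : 2 * (3 * r - 2) - 2 = 2 * (2 * g' - 2) + (2 * r + 2)) :
    g' = r - 1 := by
  omega

/-- RIES §1.1: Riemann–Hurwitz for the degree-3 map `C' → ℙ¹` of a curve of genus `d` with simple
branching, `2d − 2 = 3·(−2) + b`, gives `b = 2d + 4` branch points (`= 2r + 2` for `d = r − 1`). -/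
theorem trigonal_branch_points (d r b : ℤ) (hd : d = r - 1) (h : 2 * d - 2 = 3 * (-2) + b) :
    b = 2 * d + 4 ∧ b = 2 * r + 2 := by
  omega

/-- RIES §1.2: the `S₃`-isotypic bookkeeping of `H¹(C̃, ℚ) = triv^a ⊕ sgn^b ⊕ std^c`: the invariants
under `S₃`, `⟨σ⟩`, `⟨ι̃⟩` have dimensions `a = 2·g(ℙ¹) = 0`, `a + b = 2r`, `a + c = 2d`; with `d = r − 1`
this gives `b = 2r`, `c = 2d` and the total `a + b + 2c = 2(3r − 2) = 2·g(C̃)`. -/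
theorem isotypic_bookkeeping (r d a b c : ℤ) (hd : d = r - 1) (hG : a = 0) (hσ : a + b = 2 * r)
    (hι : a + c = 2 * d) : b = 2 * r ∧ c = 2 * d ∧ a + b + 2 * c = 2 * (3 * r - 2) := by
  omega

/-- RIES §1.3: the trace form of `ℤ[ζ₃]` in the basis `(1, ζ)` has Gram matrix `[[2, −1], [−1, 2]]` and
determinant `3`. -/
theorem trace_form_det : Matrix.det !![(2 : ℤ), -1; -1, 2] = 3 := by
  simp [Matrix.det_fin_two]

/-- RIES §1.3 (e): `det(Tr ⊗ θ) = det(Tr)^{2d} · det(θ)² = 3^{2d}` has square root `3^d`, the Pfaffian of the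
Prym polarisation of type `(1^d, 3^d)`; `deg φ · Pf(Ξ) = Pf(φ^*Ξ)` then forces `deg φ = 1`. -/
theorem pfaffian_degree_one (d deg : ℕ) (h : deg * 3 ^ d = 3 ^ d) : deg = 1 := by
  have hpos : 0 < 3 ^ d := Nat.pos_of_ne_zero (pow_ne_zero d (by norm_num))
  have : deg * 3 ^ d = 1 * 3 ^ d := by simpa using h
  exact Nat.eq_of_mul_eq_mul_right hpos this

/-- The determinant identity used in `pfaffian_degree_one`. -/
theorem det_tensor (d : ℕ) : (3 : ℕ) ^ (2 * d) = (3 ^ d) ^ 2 := by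
  rw [← pow_mul, Nat.mul_comm]

/-- RIES §4.5 (THEOREM CENSUS∞): with `w_t = ((−1)^d/3)(ω^tΩ + ω^{-t}Ω̄)`, `Ω² = Ω̄² = 0`, `Ω·Ω̄ = (−3)^d`
and `ω^t ω^{−t} = 1`, the self-pairing is `B(w_t, w_t) = 2·((−1)^d/3)²·(−3)^d = (2/9)(−3)^d`, and for
`d ≥ 2` this is ALB's `(−1)^d · 2 · 3^{d−2}` (stated for `d = e + 2`). -/
theorem weil_self_pairing (e : ℕ) :
    2 * ((-1 : ℚ) ^ (e + 2) / 3) ^ 2 * (-3 : ℚ) ^ (e + 2) = (-1) ^ (e + 2) * 2 * 3 ^ e := by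
  have h1 : ((-1 : ℚ) ^ (e + 2)) ^ 2 = 1 := by
    rw [← pow_mul]
    exact Even.neg_one_pow ⟨e + 2, by ring⟩
  have h2 : (-3 : ℚ) ^ (e + 2) = (-1) ^ (e + 2) * 3 ^ (e + 2) := by
    rw [← mul_pow]; norm_num
  rw [div_pow, h1, h2]
  ring

/-- RIES §4.1/§4.5: the census numbers at `d = 1, 2, 3, 4`: `S_t·Ξ^d = (2d)!·3^{d−1}/d!` is
`2, 36, 1080, 45360`; `S_t² = (2d)!·3^d/(9·d!²) + (2/9)(−3)^d` is `0, 8, 54, 648`;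
`Ξ^{2d} = (2d)!·3^d` is `6, 216, 19440, 3265920`. -/
theorem census_numbers_d_le_4 :
    ((Nat.factorial 2 : ℚ) * 3 ^ 0 / Nat.factorial 1 = 2 ∧
      (Nat.factorial 4 : ℚ) * 3 ^ 1 / Nat.factorial 2 = 36 ∧
      (Nat.factorial 6 : ℚ) * 3 ^ 2 / Nat.factorial 3 = 1080 ∧
      (Nat.factorial 8 : ℚ) * 3 ^ 3 / Nat.factorial 4 = 45360) ∧
    ((Nat.factorial 2 : ℚ) * 3 ^ 1 / (9 * (Nat.factorial 1) ^ 2) + 2 / 9 * (-3) ^ 1 = 0 ∧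
      (Nat.factorial 4 : ℚ) * 3 ^ 2 / (9 * (Nat.factorial 2) ^ 2) + 2 / 9 * (-3) ^ 2 = 8 ∧
      (Nat.factorial 6 : ℚ) * 3 ^ 3 / (9 * (Nat.factorial 3) ^ 2) + 2 / 9 * (-3) ^ 3 = 54 ∧
      (Nat.factorial 8 : ℚ) * 3 ^ 4 / (9 * (Nat.factorial 4) ^ 2) + 2 / 9 * (-3) ^ 4 = 648) ∧
    (Nat.factorial 2 * 3 ^ 1 = 6 ∧ Nat.factorial 4 * 3 ^ 2 = 216 ∧
      Nat.factorial 6 * 3 ^ 3 = 19440 ∧ Nat.factorial 8 * 3 ^ 4 = 3265920) := by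
  refine ⟨⟨?_, ?_, ?_, ?_⟩, ⟨?_, ?_, ?_, ?_⟩, ⟨?_, ?_, ?_, ?_⟩⟩ <;> norm_num [Nat.factorial]

/-- RIES §4.5: the closed form `S_t² = 3^{d−2}(C(2d, d) + 2(−1)^d)` at `d = 2, 3, 4, 5`:
`8, 54, 648, 6750`. -/
theorem census_square_closed_form :
    3 ^ 0 * (Nat.choose 4 2 + 2) = 8 ∧ (3 : ℤ) ^ 1 * (Nat.choose 6 3 - 2) = 54 ∧
      3 ^ 2 * (Nat.choose 8 4 + 2) = 648 ∧ (3 : ℤ) ^ 3 * (Nat.choose 10 5 - 2) = 6750 := by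
  refine ⟨by decide, ?_, by decide, ?_⟩
  · have : Nat.choose 6 3 = 20 := by decide
    simp [this]
  · have : Nat.choose 10 5 = 252 := by decide
    simp [this]

/-- RIES §2.3/§4.2 (d = 4, type 0): the strata (4,0,0), (1,3,0), (1,0,3), (0,2,2), (2,1,1) have multinomial
coefficients 1, 4, 4, 6, 12 summing to `27 = 3^{d−1}`, and degrees `3^4 · μ` over `|K_X|` summing to
`2187 = 3^{2d−1}`; the Weil shares `μ/27` sum to `1`. -/
theorem type_zero_multinomials :
    Nat.factorial 4 / (Nat.factorial 4 * Nat.factorial 0 * Nat.factorial 0) = 1 ∧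
    Nat.factorial 4 / (Nat.factorial 1 * Nat.factorial 3 * Nat.factorial 0) = 4 ∧
    Nat.factorial 4 / (Nat.factorial 0 * Nat.factorial 2 * Nat.factorial 2) = 6 ∧
    Nat.factorial 4 / (Nat.factorial 2 * Nat.factorial 1 * Nat.factorial 1) = 12 ∧
    1 + 4 + 4 + 6 + 12 = 3 ^ 3 ∧ 3 ^ 4 * (1 + 4 + 4 + 6 + 12) = 3 ^ 7 ∧ (3 : ℕ) ^ 7 = 2187 ∧
    ((1 : ℚ) + 4 + 4 + 6 + 12) / 27 = 1 := by
  refine ⟨by decide, by decide, by decide, by decide, by norm_num, by norm_num, by norm_num, by norm_num⟩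

/-- RIES §4.2 (d = 4): the `Ξ^4`-components `a_(m)·3·4!` of the five type-0 strata are
`8/945, 104/945, 104/945, 219/945, 510/945` and sum to `1` (the `Ξ^4/72` of Schoen's class). -/
theorem xi_shares_sum_to_one :
    (8 : ℚ) / 945 + 104 / 945 + 104 / 945 + 219 / 945 + 510 / 945 = 1 ∧
    (73 : ℚ) / 315 = 219 / 945 ∧ (34 : ℚ) / 63 = 510 / 945 ∧ (13 : ℚ) / 8505 * 3 * 24 = 104 / 945 ∧
    (1 : ℚ) / 8505 * 3 * 24 = 8 / 945 := by
  norm_num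

/-- RIES §4.1 (d = 4, type 0): the intersection matrix of the five strata in the order
(022), (103), (130), (211), (400) is `[[36,0,0,108,6],[0,0,24,48,0],[0,24,0,48,0],[108,48,48,144,0],
[6,0,0,0,0]]`; the sum of all its entries is `[X_t]² = 648`. -/
theorem intersection_matrix_total :
    (36 + 0 + 0 + 108 + 6) + (0 + 0 + 24 + 48 + 0) + (0 + 24 + 0 + 48 + 0) +
      (108 + 48 + 48 + 144 + 0) + (6 + 0 + 0 + 0 + 0) = 648 := by
  norm_num

/-- RIES §6.4, calibration of the (x, θ)-calculus on `C^{(2)}` (`x² = 1`, `xθ = g`, `θ² = g(g−1)`):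
the diagonal `Δ = αx + βθ` with `Δ·x = 2`, `Δ·θ = 4g` has `β = −2`, `α = 2g + 2`, provided `g ≠ 0`. -/
theorem diagonal_class (g α β : ℚ) (hg : g ≠ 0) (h1 : α + β * g = 2)
    (h2 : α * g + β * (g * (g - 1)) = 4 * g) : β = -2 ∧ α = 2 * g + 2 := by
  have h2' : α + β * (g - 1) = 4 := by
    have : (α + β * (g - 1)) * g = 4 * g := by linear_combination h2
    exact mul_right_cancel₀ hg this
  constructor
  · linear_combination h1 - h2'
  · linear_combination h1 - g * (h1 - h2')

/-- RIES §6.4, calibration continued: `Δ² = (2(g+1)x − 2θ)² = 4 − 4g = deg N_{Δ/C^{(2)}} = 2(2 − 2g)`. -/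
theorem diagonal_self_int (g : ℚ) :
    (2 * (g + 1)) ^ 2 * 1 - 2 * (2 * (g + 1)) * 2 * g + 4 * (g * (g - 1)) = 4 - 4 * g ∧
      (4 : ℚ) - 4 * g = 2 * (2 - 2 * g) := by
  constructor <;> ring

/-- RIES §6.4: the trigonal correspondence curve `T = αx + βθ ⊂ C'^{(2)}` (genus `4`: `x² = 1`, `xθ = 4`,
`θ² = 12`) with `T·x = 2`, `T·θ = 4` has `α = −2`, `β = 1`, i.e. `[T] = θ − 2x`, and then `T² = 0`;
this agrees with `c₁` of the tautological bundle of the `g¹₃`: `(deg − g − n + 1) = 3 − 4 − 2 + 1 = −2`. -/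
theorem trigonal_pair_class (α β : ℚ) (h1 : α * 1 + β * 4 = 2) (h2 : α * 4 + β * 12 = 4) :
    α = -2 ∧ β = 1 ∧ α ^ 2 * 1 + 2 * α * β * 4 + β ^ 2 * 12 = 0 ∧ (3 : ℤ) - 4 - 2 + 1 = -2 := by
  have hb : β = 1 := by linear_combination (h2 - 4 * h1) / (-4)
  have ha : α = -2 := by linear_combination h1 - 4 * hb
  subst hb; subst ha
  norm_num

/-- RIES §6.4: the trigonal bisecant divisor `Sec = a·x + b·θ ⊂ C'^{(4)}` (`x⁴ = 1`, `x³θ = 4`,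
`x²θ² = 12`) with `Sec·x³ = 3·2·1 = 6` and `Sec·x²θ = 2·2·4 + (12 − 8)·1 = 20` has `a = 2`, `b = 1`. -/
theorem bisecant_class (a b : ℚ) (h1 : a * 1 + b * 4 = 3 * 2 * 1)
    (h2 : a * 4 + b * 12 = 2 * 2 * 4 + (12 - 8) * 1) : a = 2 ∧ b = 1 := by
  have hb : b = 1 := by linear_combination (h2 - 4 * h1) / (-4)
  have ha : a = 2 := by linear_combination h1 - 4 * hb
  exact ⟨ha, hb⟩

/-- RIES §6.4 control count: on the curve `{2p + E₁}` (`x = 2`, `θ = 16`), `Sec = 2x + θ` counts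
`20 = 12·1 + 4·2` (the `2g' + 4 = 12` ramification points of the `g¹₃` once, the four incidences with
`E₁` twice). -/
theorem bisecant_control_count : 2 * 2 + 1 * 16 = 12 * 1 + 4 * 2 ∧ 2 * 4 + 4 = 12 := by
  norm_num

/-- RIES §6.4 (α): on the test curve `R_E ≅ C'` of the double locus (`x·R_E = 2`, `θ·R_E = 4`) the degree
of `T¹_{X₀} = N_{D/S_{400}} ⊗ N_{D/S_{211}}` is `Sec·R_E + deg T_{C'} = (2·2 + 1·4) + (2 − 2·4) = 2 ≠ 0`:
the Ries carrier is not d-semistable. -/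
theorem not_d_semistable_degree :
    (2 * 2 + 1 * 4 : ℤ) + (2 - 2 * 4) = 2 ∧ (2 : ℤ) ≠ 0 := by
  norm_num

/-- RIES §2.4 / §6.2: at `d = 4`, type 0, the dual graph of the Ries carrier has 5 vertices and 6 edges,
first Betti number `6 − 5 + 1 = 2`; the heuristic log-deformation count is
`9 + 2 + 1 = 12 = 3r − 3` (`r = 5`), the number REMARK SC wants; the Ries locus has dimension
`2r − 1 = 9` inside the `3r − 3 = 12`-dimensional base and maps to the `d(d+1)/2 = 10`-dimensional split
locus of the `d² = 16`-dimensional `S`. -/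
theorem route_bookkeeping :
    (6 : ℤ) - 5 + 1 = 2 ∧ 9 + 2 + 1 = 3 * 5 - 3 ∧ 2 * 5 - 1 = 9 ∧ 4 * (4 + 1) / 2 = 10 ∧ 4 ^ 2 = 16 := by
  norm_num

end Summit.Ventures.HSemireg.SchoenCarrierRiesCensus
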